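import Summits.Ventures.DiscreteObjects.Hadamard.AutomorphismTransfer668B
import Summits.Ventures.DiscreteObjects.Hadamard.PrimeOrderFixedSubstructure

/-!
# Hadamard 668 census, family F12 — how many rows an automorphism of order 83, 41, 37 of H(668) fixes (kernel)

Framing: lottery ticket; floor = certified bounds/negative ranges.

Cell pub-namedobj (venture DiscreteObjects), target (H), hadamard gen 6.  A packaged form of the transfer
(`transfer668`: from a signed-permutation automorphism of a Hadamard matrix of order `668` fixing row `r` and column `c` to the
`0/1` structure on `{i ≠ r} × {j ≠ c}` with both halves of the symmetric-design identities, the induced pair `(ρ, τ)`, and the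
dictionary `ρ x = x ↔ π x = x`), the count `#{i | π i = i} = #{x | ρ x = x} + 1` (`card_fixed_eq_succ`), and the corollaries of
`PrimeOrderFixedSubstructure`: a signed-permutation automorphism `(π, κ, d, e)` of a Hadamard matrix of order `668` with
`π^p = κ^p = 1`, `(π, κ) ≠ (1, 1)` has **exactly `4` fixed rows and `4` fixed columns if `p = 83`, exactly `12` and `12` if
`p = 41`, exactly `2` and `2` if `p = 37`** (`hadamard668_fixedRows_83/41/37`; 'fixed row' = `π i = i`, the sign being `+`
automatically is not asserted).  Ours, not literature; no `sorry`.
-/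

open Finset BigOperators Matrix

namespace Summit.Ventures.DiscreteObjects.Hadamard

open Literature.Combinatorics.Designs.GoethalsSeidel (IsHadamardMatrix)

variable {ι : Type*} [Fintype ι] [DecidableEq ι]

/-- fixed points of `π` versus fixed points of its restriction to `{i // i ≠ r}` when `π r = r` -/
lemma card_fixed_eq_succ (π : Equiv.Perm ι) (r : ι) (hr : π r = r) (hπr : ∀ i, π i ≠ r ↔ i ≠ r) :
    (univ.filter fun i => π i = i).card = (univ.filter fun x : {i // i ≠ r} => π.subtypePerm hπr x = x).card + 1 := by
  have key : (univ.filter fun i => π i = i) =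
      insert r ((univ.filter fun x : {i // i ≠ r} => π.subtypePerm hπr x = x).map (Function.Embedding.subtype _)) := by
    ext i
    constructor
    · intro hi
      rw [Finset.mem_filter] at hi
      rw [Finset.mem_insert, Finset.mem_map]
      by_cases hir : i = r
      · exact Or.inl hir
      · right
        refine ⟨⟨i, hir⟩, ?_, rfl⟩
        rw [Finset.mem_filter]
        exact ⟨Finset.mem_univ _, Subtype.ext hi.2⟩
    · intro hi
      rw [Finset.mem_insert, Finset.mem_map] at hi
      rw [Finset.mem_filter]
      refine ⟨Finset.mem_univ _, ?_⟩
      rcases hi with h | ⟨x, hx, hxi⟩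
      · rw [h, hr]
      · rw [Finset.mem_filter] at hx
        have e := congrArg Subtype.val hx.2
        rw [Equiv.Perm.subtypePerm_apply] at e
        rw [← hxi]
        exact e
  have hnot : r ∉ (univ.filter fun x : {i // i ≠ r} => π.subtypePerm hπr x = x).map (Function.Embedding.subtype _) := by
    intro h
    rw [Finset.mem_map] at h
    obtain ⟨x, -, hx⟩ := h
    exact x.2 hx
  rw [key, Finset.card_insert_of_notMem hnot, Finset.card_map]

/-- **Packaged transfer.**  From a signed automorphism of a Hadamard matrix of order `668` with `π^p = κ^p = 1`, `π ≠ 1`,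
`π r = r`, `κ c = c`: the `0/1` structure `inc H r c` on `{i ≠ r} × {j ≠ c}` with row/column sums `333`, distinct-row/column
products `166`, `667 + 667` elements, the induced automorphism pair with `p`-th powers `1`, a moved point, and the fixed-point
dictionaries. -/
theorem transfer668 {H : Matrix ι ι ℤ} {r c : ι} (hH : IsHadamardMatrix H) (hι : Fintype.card ι = 668) (p : ℕ)
    (π κ : Equiv.Perm ι) (d e : ι → ℤ) (haut : IsSignedAut H π κ d e)
    (hπ : π ^ p = 1) (hκ : κ ^ p = 1) (hne : π ≠ 1) (hr : π r = r) (hc : κ c = c) :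
    ∃ (hπr : ∀ i, π i ≠ r ↔ i ≠ r) (hκc : ∀ j, κ j ≠ c ↔ j ≠ c),
      (∀ (x : {i // i ≠ r}) (y : {j // j ≠ c}), inc H r c x.1 y.1 = 0 ∨ inc H r c x.1 y.1 = 1) ∧
      (∀ x : {i // i ≠ r}, ∑ y : {j // j ≠ c}, inc H r c x.1 y.1 = 333) ∧
      (∀ x x' : {i // i ≠ r}, x ≠ x' → ∑ y : {j // j ≠ c}, inc H r c x.1 y.1 * inc H r c x'.1 y.1 = 166) ∧
      (∀ y : {j // j ≠ c}, ∑ x : {i // i ≠ r}, inc H r c x.1 y.1 = 333) ∧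
      (∀ y y' : {j // j ≠ c}, y ≠ y' → ∑ x : {i // i ≠ r}, inc H r c x.1 y.1 * inc H r c x.1 y'.1 = 166) ∧
      Fintype.card {i // i ≠ r} = 667 ∧ Fintype.card {j // j ≠ c} = 667 ∧
      (∀ (x : {i // i ≠ r}) (y : {j // j ≠ c}), inc H r c (π.subtypePerm hπr x).1 (κ.subtypePerm hκc y).1 = inc H r c x.1 y.1) ∧
      (π.subtypePerm hπr : Equiv.Perm {i // i ≠ r}) ^ p = 1 ∧ (κ.subtypePerm hκc : Equiv.Perm {j // j ≠ c}) ^ p = 1 ∧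
      (∃ x₀ : {i // i ≠ r}, (π.subtypePerm hπr : Equiv.Perm {i // i ≠ r}) x₀ ≠ x₀) := by
  have hπr : ∀ i, π i ≠ r ↔ i ≠ r := by
    intro i
    constructor
    · intro h hi; exact h (by rw [hi, hr])
    · intro h hi; exact h (π.injective (by rw [hi, hr]))
  have hκc : ∀ j, κ j ≠ c ↔ j ≠ c := by
    intro j
    constructor
    · intro h hj; exact h (by rw [hj, hc])
    · intro h hj; exact h (κ.injective (by rw [hj, hc]))
  refine ⟨hπr, hκc, fun x y => inc_01 x.1 y.1, ?_, ?_, ?_, ?_, ?_, ?_, ?_, ?_, ?_, ?_⟩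
  · intro x
    rw [sum_subtype_ne (fun j => inc H r c x.1 j) c, inc_rowsum_full hH hι x.2, inc_col hH]
    norm_num
  · intro x x' hxx'
    have hne' : x.1 ≠ x'.1 := fun h => hxx' (Subtype.ext h)
    rw [sum_subtype_ne (fun j => inc H r c x.1 j * inc H r c x'.1 j) c, inc_pair_full hH hι x.2 x'.2 hne',
      inc_col hH, inc_col hH]
    norm_num
  · intro y
    rw [sum_subtype_ne (fun i => inc H r c i y.1) r, inc_colsum_full hH hι y.2]
    have : inc H r c r y.1 = 1 := by unfold inc; rw [if_pos (nrm_row hH y.1)]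
    rw [this]; norm_num
  · intro y y' hyy'
    have hne' : y.1 ≠ y'.1 := fun h => hyy' (Subtype.ext h)
    rw [sum_subtype_ne (fun i => inc H r c i y.1 * inc H r c i y'.1) r, inc_cpair_full hH hι y.2 y'.2 hne']
    have e1 : inc H r c r y.1 = 1 := by unfold inc; rw [if_pos (nrm_row hH y.1)]
    have e2 : inc H r c r y'.1 = 1 := by unfold inc; rw [if_pos (nrm_row hH y'.1)]
    rw [e1, e2]; norm_num
  · rw [card_subtype_ne', hι]
  · rw [card_subtype_ne', hι]
  · intro x y
    exact inc_aut haut hr hc x.1 y.1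
  · ext x
    simp [Equiv.Perm.subtypePerm_pow, hπ]
  · ext y
    simp [Equiv.Perm.subtypePerm_pow, hκ]
  · obtain ⟨i₀, hi₀⟩ : ∃ i, π i ≠ i := by
      by_contra h
      exact hne (Equiv.ext fun i => not_not.mp (not_exists.mp h i))
    have hi₀r : i₀ ≠ r := fun h => hi₀ (by rw [h, hr])
    refine ⟨⟨i₀, hi₀r⟩, ?_⟩
    intro h
    apply hi₀
    have := congrArg Subtype.val h
    simpa using this

/-- fixed row and column of a nontrivial signed automorphism of odd prime order `p ∤ 668`, with `π ≠ 1` -/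
private lemma fixed_row_col {H : Matrix ι ι ℤ} (hH : IsHadamardMatrix H) (hι : Fintype.card ι = 668) (p : ℕ)
    (hp : p.Prime) (hpd : ¬ p ∣ 668) (hodd : Odd p)
    (π κ : Equiv.Perm ι) (d e : ι → ℤ) (haut : IsSignedAut H π κ d e)
    (hπ : π ^ p = 1) (hκ : κ ^ p = 1) (hne : π ≠ 1 ∨ κ ≠ 1) :
    π ≠ 1 ∧ (∃ r, π r = r) ∧ (∃ c, κ c = c) := by
  have hcard : (Fintype.card ι : ℤ) ≠ 0 := by rw [hι]; norm_num
  have hπ1 : π ≠ 1 := by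
    rcases hne with h | h
    · exact h
    · intro hπ1
      apply h
      rw [hπ1] at haut
      exact signedAut_snd_eq_one H hH hcard haut hodd hκ
  have hnd : ¬ p ∣ Fintype.card ι := by rw [hι]; exact hpd
  haveI : Fact p.Prime := ⟨hp⟩
  exact ⟨hπ1, Equiv.Perm.exists_fixed_point_of_prime (n := 1) hnd (σ := π) (by rw [pow_one]; exact hπ),
    Equiv.Perm.exists_fixed_point_of_prime (n := 1) hnd (σ := κ) (by rw [pow_one]; exact hκ)⟩

/-- **Order 83: exactly 4 fixed rows and 4 fixed columns.** -/
theorem hadamard668_fixedRows_83 {H : Matrix ι ι ℤ} (hH : IsHadamardMatrix H) (hι : Fintype.card ι = 668)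
    (π κ : Equiv.Perm ι) (d e : ι → ℤ) (haut : IsSignedAut H π κ d e)
    (hπ : π ^ 83 = 1) (hκ : κ ^ 83 = 1) (hne : π ≠ 1 ∨ κ ≠ 1) :
    (univ.filter fun i => π i = i).card = 4 ∧ (univ.filter fun j => κ j = j).card = 4 := by
  obtain ⟨hπ1, ⟨r, hr⟩, ⟨c, hc⟩⟩ :=
    fixed_row_col hH hι 83 (by norm_num) (by norm_num) (by decide) π κ d e haut hπ hκ hne
  obtain ⟨hπr, hκc, h01, hrow, hpair, hcol, hcpair, hP, hB, hN, hρ, hτ, x₀, hx₀⟩ :=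
    transfer668 hH hι 83 π κ d e haut hπ hκ hπ1 hr hc
  have h := fixedSubstructure_83 (fun (x : {i // i ≠ r}) (y : {j // j ≠ c}) => inc H r c x.1 y.1) h01 hrow hpair hcol
    hcpair hP hB (π.subtypePerm hπr) (κ.subtypePerm hκc) hN hρ hτ x₀ hx₀
  constructor
  · rw [card_fixed_eq_succ π r hr hπr, h.2.1]
  · rw [card_fixed_eq_succ κ c hc hκc, h.1.1]

/-- **Order 41: exactly 12 fixed rows and 12 fixed columns.** -/
theorem hadamard668_fixedRows_41 {H : Matrix ι ι ℤ} (hH : IsHadamardMatrix H) (hι : Fintype.card ι = 668)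
    (π κ : Equiv.Perm ι) (d e : ι → ℤ) (haut : IsSignedAut H π κ d e)
    (hπ : π ^ 41 = 1) (hκ : κ ^ 41 = 1) (hne : π ≠ 1 ∨ κ ≠ 1) :
    (univ.filter fun i => π i = i).card = 12 ∧ (univ.filter fun j => κ j = j).card = 12 := by
  obtain ⟨hπ1, ⟨r, hr⟩, ⟨c, hc⟩⟩ :=
    fixed_row_col hH hι 41 (by norm_num) (by norm_num) (by decide) π κ d e haut hπ hκ hne
  obtain ⟨hπr, hκc, h01, hrow, hpair, hcol, hcpair, hP, hB, hN, hρ, hτ, x₀, hx₀⟩ :=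
    transfer668 hH hι 41 π κ d e haut hπ hκ hπ1 hr hc
  have h := fixedSubstructure_41 (fun (x : {i // i ≠ r}) (y : {j // j ≠ c}) => inc H r c x.1 y.1) h01 hrow hpair hcol
    hcpair hP hB (π.subtypePerm hπr) (κ.subtypePerm hκc) hN hρ hτ x₀ hx₀
  constructor
  · rw [card_fixed_eq_succ π r hr hπr, h.2.1]
  · rw [card_fixed_eq_succ κ c hc hκc, h.1.1]

/-- **Order 37: exactly 2 fixed rows and 2 fixed columns.** -/
theorem hadamard668_fixedRows_37 {H : Matrix ι ι ℤ} (hH : IsHadamardMatrix H) (hι : Fintype.card ι = 668)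
    (π κ : Equiv.Perm ι) (d e : ι → ℤ) (haut : IsSignedAut H π κ d e)
    (hπ : π ^ 37 = 1) (hκ : κ ^ 37 = 1) (hne : π ≠ 1 ∨ κ ≠ 1) :
    (univ.filter fun i => π i = i).card = 2 ∧ (univ.filter fun j => κ j = j).card = 2 := by
  obtain ⟨hπ1, ⟨r, hr⟩, ⟨c, hc⟩⟩ :=
    fixed_row_col hH hι 37 (by norm_num) (by norm_num) (by decide) π κ d e haut hπ hκ hne
  obtain ⟨hπr, hκc, h01, hrow, hpair, hcol, hcpair, hP, hB, hN, hρ, hτ, x₀, hx₀⟩ :=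
    transfer668 hH hι 37 π κ d e haut hπ hκ hπ1 hr hc
  have h := fixedSubstructure_37 (fun (x : {i // i ≠ r}) (y : {j // j ≠ c}) => inc H r c x.1 y.1) h01 hrow hpair hcol
    hcpair hP hB (π.subtypePerm hπr) (κ.subtypePerm hκc) hN hρ hτ x₀ hx₀
  constructor
  · rw [card_fixed_eq_succ π r hr hπr, h.2.1]
  · rw [card_fixed_eq_succ κ c hc hκc, h.1.1]

end Summit.Ventures.DiscreteObjects.Hadamard
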